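import Summits.CriticalPhenomena.Ising3D.TaylorRegionDeltaLitOdd
import HarnessLib

/-!
# `sizesOK` of the wide-box region data from its parts (one kernel declaration per δ-table family)
(cell `pub-ising3x`, seat recog-1 gen 13; gate (g2) — kernel measurements HOME/pub-ising3x-recog-1/gen13/KERNEL-DELTA.md)

HONEST FRAMING: lottery ticket; floor = tightest certified 3D Ising CFT bounds; no exact-solution
claim without a proof. Island framing: certified exclusion region at stated derivative order and
assumptions; not a determination of the 3D Ising critical exponents beyond that.

MEASURED on a real `Λ = 11` functional: every part of `EvenRegionDataΔ.sizesOK` decides in the kernel in 12–17 s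
(`toH.sizesOK`, each `deltaSizeOK` — lazily, only table SHAPES are evaluated), but the conjunction as ONE declaration
does not come back (`decide` reports no verdict after 34 s, reproducibly). These two lemmas let a certificate file decide
the parts separately: **`EvenRegionDataΔ.sizesOK_of_parts`**, **`OddConeRegionDataΔ.sizesOK_of_parts`**. [folklore]
-/

namespace Summit.CriticalPhenomena.Ising3D

open Literature.Analysis.ValidatedNumerics Literature.Analysis.ValidatedNumerics.PolyMP
open Literature.Analysis.ValidatedNumerics.NumericsMP (MI)

namespace EvenRegionDataΔ

/-- **`sizesOK` from its parts** (even). [folklore] -/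
theorem sizesOK_of_parts (d : EvenRegionDataΔ) (h0 : d.toH.sizesOK = true) (hσ : d.σlo ≤ d.σhi) (hε : d.εlo ≤ d.εhi)
    (hX : deltaSizeOK d.S (d.cQ 0) (-1) d.σ0 d.Wσ d.ccQ d.l d.N = true)
    (hY : deltaSizeOK d.S (d.cQ 1) (-1) d.ε0 d.Wε d.ccQ d.l d.N = true)
    (h3 : deltaSizeOK d.S (d.cQ 3) (-1) d.b0 d.Wb d.ccQ d.l d.N = true)
    (h4 : deltaSizeOK d.S (d.cQ 4) 1 d.b0 d.Wb d.ccQ d.l d.N = true) : d.sizesOK = true := by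
  simp only [sizesOK, h0, hX, hY, h3, h4, hσ, hε, decide_true, Bool.and_self]

end EvenRegionDataΔ

namespace OddConeRegionDataΔ

/-- **`sizesOK` from its parts** (odd). [folklore] -/
theorem sizesOK_of_parts (d : OddConeRegionDataΔ) (h0 : d.toCertH.data.sizesOK = true) (hσ : d.σlo ≤ d.σhi)
    (hε : d.εlo ≤ d.εhi) (h3 : deltaSizeOK d.S (d.cQ 2) (-1) d.b0 d.Wb d.ccQ d.l d.N = true)
    (h4 : deltaSizeOK d.S (d.cQ 3) (-1) d.σ0 d.Wσ d.ccQ d.l d.N = true)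
    (h5 : deltaSizeOK d.S (d.cQ 4) 1 d.σ0 d.Wσ d.ccQ d.l d.N = true)
    (hψ0 : deltaSizeOK d.S d.ψQ 0 0 0 d.ccQ d.lψ d.N = true)
    (hψt : deltaSizeOK d.S d.ψQ 0 d.t0 d.Wt d.ccQ d.lψ d.N = true) : d.sizesOK = true := by
  simp only [sizesOK, h0, h3, h4, h5, hψ0, hψt, hσ, hε, decide_true, Bool.and_self]

end OddConeRegionDataΔ

end Summit.CriticalPhenomena.Ising3D
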